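import Literature.IUT.HodgeTheaters.DiscreteProfiniteConjugatesProofs
import Literature.IUT.HodgeTheaters.SurfaceGroupBridge
import Literature.GroupTheory.CombinatorialGroupTheory.SurfaceGroupAbelianSubgroups
import HarnessLib

/-!
# [IUTchI] Lemma 2.7 (iv) for orientable surface groups: abelian subgroups are cyclic

Topic `Literature/IUT/HodgeTheaters`; theorems only (proof companion; no statement of
`DiscreteProfiniteConjugates.lean` is touched).  Mochizuki, *Inter-universal Teichmüller Theory
I*, Lemma 2.7 (iv) (kurims p. 57, "well-known"): for `G` free of finite rank or an orientable
surface group, every abelian subgroup of `G` is cyclic.  The free half and the reduction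
`abelianSubgroupCyclic_of_surfaceCase` are `DiscreteProfiniteConjugatesProofs.lean` (abc-iut-L5-t9);
this file supplies the ORIENTABLE-SURFACE-GROUP HALF and closes the named statement:

* `abelianSubgroupCyclic_surfaceCase` — `IsOrientableSurfaceGroup G →` every abelian subgroup of
  `G` is cyclic (via `S_g ≅ F_{2g-2} *_ℤ F_2` and the centralizer theorem for malnormal amalgams,
  `Literature/GroupTheory/CombinatorialGroupTheory/SurfaceGroupAbelianSubgroups.lean`, transported
  through `SurfaceGroupBridge.lean`);
* `FreeOrSurface.abelianSubgroupCyclic_holds` — **Lemma 2.7 (iv) as typed**, unconditionally.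

## References

* S. Mochizuki, *Inter-universal Teichmüller Theory I*, PRIMS 57 (2021), Lemma 2.7 (iv).
  [Mochizuki2012]
* W. Magnus, A. Karrass, D. Solitar, *Combinatorial Group Theory*, Interscience (1966), §4.2
  Cor. 4.5. [MagnusKarrassSolitar1966]
-/

noncomputable section

namespace Literature.IUT.HodgeTheaters

open Literature.GroupTheory.CombinatorialGroupTheory

universe u

/-- **[IUTchI] Lemma 2.7 (iv), orientable-surface-group half**: every abelian subgroup of an
orientable surface group (genus `≥ 2`) is cyclic — stated in the hypothesis shape of
`FreeOrSurface.abelianSubgroupCyclic_of_surfaceCase`. [cite: Mochizuki2012, Lem 2.7(iv) p.57] -/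
theorem abelianSubgroupCyclic_surfaceCase (G : Type u) [Group G] (hG : IsOrientableSurfaceGroup G)
    (J : Subgroup G) (hJ : ∀ a ∈ J, ∀ b ∈ J, a * b = b * a) : IsCyclic J := by
  obtain ⟨g, hg, ⟨e₁⟩⟩ := hG
  obtain ⟨e₂⟩ := exists_mulEquiv_surfaceGroup g
  exact isCyclic_of_forall_commute_of_mulEquiv (e₁.trans e₂)
    (fun J' hJ' => surfaceGroup_isCyclic_of_forall_commute hg J' hJ') J hJ

/-- **[IUTchI] Lemma 2.7 (iv)** (kurims p. 57) holds as typed: for `G` free of finite rank or an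
orientable surface group, every abelian subgroup of `G` is cyclic.
[cite: Mochizuki2012, Lem 2.7(iv) p.57] -/
theorem FreeOrSurface.abelianSubgroupCyclic_holds : FreeOrSurface.abelianSubgroupCyclic.{u} :=
  FreeOrSurface.abelianSubgroupCyclic_of_surfaceCase abelianSubgroupCyclic_surfaceCase

end Literature.IUT.HodgeTheaters
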